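import Summits.MatrixMultiplication.MatrixMultiplication.Theorems.FarEdgeDescentStrassenFloorShift
import Summits.MatrixMultiplication.MatrixMultiplication.Theorems.FarEdgeDescentTower
import Literature.Computability.AlgebraicComplexity.RectangularExponentAlpha
import HarnessLib

/-!
# Far-edge descent, kernel XXXIX-C: what Strassen's floors do to the anchored objects, the bare multiples, the dial's budget factor and the one-shot readout

Route `FarEdgeDescent`, special leaf `FiniteSaturation` (stmt-MatrixMultiplication-23739): helper
kernel, THESES-FREE and definition-free (decomp-mm lens 2 «structural dichotomy: special vs generic»,
gen 59).  Consequences of the two floors for `D = ⊕ᵢ⟨kᵢ,mᵢ,kᵢ⟩`, `L = ∑kᵢmᵢ`, `M = ∑mᵢ`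
(`FarEdgeDescentStrassenFloor.floor`: `L + ∑_{i∈S} mᵢ ≤ R̲(D)`; `FarEdgeDescentStrassenFloorShift.floor_shift`:
`2L + ∑_{i∈S}(kᵢ−1)mᵢ ≤ 2R̲(D)`; together `4L ≤ 3R̲(D)` for genuine blocks) for the tree's certificate objects:

* §1 ANCHORED OBJECTS `⟨1,Q,1⟩ ⊕ ⊕ᵢ⟨kᵢ,mᵢ,kᵢ⟩` (`Fin.cons` format of `FarEdgeDescentTower`; the bases of the
  anchor-budget dial, kernels XXXVII/XXXVIII, cost law `r = Q + βL`): `anchored_floor` (`Q + L + ∑_S mᵢ ≤ R̲`),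
  `anchored_floor_shift`, `anchored_uniform_floor` (`3Q + 4L ≤ 3R̲`), `anchoredPair_floor`
  (`Q + aB + B ≤ R̲(⟨1,Q,1⟩ ⊕ ⟨a,B,a⟩)`; `a = 2`: `Q + 3B`, Strassen-tight on the leg up to `O(1)`),
  `anchoredPair_uniform_floor` (`3Q + 4aB ≤ 3R̲`).
* §2 THE DIAL'S BUDGET FACTOR IS BOUNDED AWAY FROM `1` — for every anchor `Q`, every number of legs, every
  field: `budget_floor_uniform` **`β ≥ 4/3`** as soon as every leg is genuine (`kᵢ ≥ 2`);
  `budget_floor` `β ≥ 1 + 1/a` for legs of width `≤ a` (`a = 2`: `β ≥ 3/2`); `budget_floor_wide`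
  `β ≥ 3/2 − 1/(2a)` for legs of width `≥ a` (wide legs are pushed to Strassen's `3/2`).  In the dial model of
  kernel XXXVIII every anchored-direct-sum toolbox therefore sits at `β ≥ 4/3`, where the power world passes
  it at order `θ_{4/3} = 2.106…` (`θ_{3/2} = 1.409…`): the interval `1 ≤ β < 4/3`, where the dial ceiling
  degenerates (`θ_β → ∞`), is EMPTY of tensors of this class.
* §3 BARE MULTIPLES `⟨c⟩ ⊗ ⟨A,M,A⟩` (the objects read out by `FarEdgeDescentTower.excess_le_of_cert`):
  `multiple_floor` `c(A+1)M ≤ R̲`, `multiple_shift_floor` `c(3A−1)M ≤ 2R̲`, `multiple_uniform_floor`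
  `4cAM ≤ 3R̲`, `not_minimal_multiple`: the relative surplus does not wash out with the multiplicity `c`.
* §4 THE `β = 1` READOUT AND ITS FLOOR: `readout` — ANY certificate `R̲(⟨c⟩ ⊗ ⟨A,M,A⟩) ≤ r` gives
  `c·A^{ω(1,x*,1)} ≤ r`, `x* = log M/log A` (the constant-free dictionary); `omegaRect_eq_of_minimal_multiple`
  — with `r = cAM` (`β = 1`) and `M = Aⁿ` it WOULD give `ω(1,n,1) = n+1`, the `∃`-witness of `FiniteSaturation`
  at `k = n`: THE SHUT DOOR, its hypothesis refuted by `not_minimal_multiple` for every `c ≥ 1`, `A ≥ 2`;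
  `readout_floor`, `readout_uniform_floor` — the readout never certifies better than
  `ω(1,x*,1) − (x*+1) ≤ log(4/3)⁻¹…`, precisely `A^{ω(1,x*,1) − (x*+1)} ≥ max(1 + 1/A, 4/3)` is all it can say.

THE DICHOTOMY IT CLOSES (lens 2, leaf `h₁`).  Among anchored direct sums of matrix products — the only bases
the tree's certificate calculus produces — the special endpoint `β = 1` and the whole range `β < 4/3` are
EMPTY (kernel XXXIX, theorems about tensors), and every `β ≥ 4/3` toolbox is power-capped in the dial model at
order `≤ θ_{4/3}` (kernel XXXVIII, a theorem about the model).  A finite-`k` saturation certificate must come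
from bases OUTSIDE this class (minimal-border-rank tensors that are not sums of matrix products — `CW_q`, where
the catalogued rectangular barriers live) or from arguments that are not border-rank certificates of direct
sums at all.  Nothing here bears on `AnchoredLogConvexity`; no upper bound on any border rank is proved.

## References
* P. Bürgisser, M. Clausen, M. A. Shokrollahi, *Algebraic Complexity Theory*, Springer 1997, Thm. (19.12).
  [BurgisserClausenShokrollahi1997]
* M. Bläser, *Fast Matrix Multiplication*, ToC Graduate Surveys 5 (2013), §5.2 p. 24. [Blaser2013]
* J. Alman, R. Duan, V. Vassilevska Williams, Y. Xu, Z. Xu, R. Zhou, SODA 2025, Thm. 3.2.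
  [AlmanDuanVassilevskaWilliamsXuXuZhou2025]
* G. Lotti, F. Romani, Theoret. Comput. Sci. 23 (1983), Prop. 4.1. [LottiRomani1983]
-/

noncomputable section

open scoped BigOperators Matrix
open Matrix

set_option linter.dupNamespace false

namespace Summit.MatrixMultiplication.MatrixMultiplication.Theorems.FarEdgeDescentStrassenFloorReadout

open Literature.Computability.AlgebraicComplexity
open Summit.MatrixMultiplication.MatrixMultiplication.Theorems.FarEdgeDescentStrassenFloor
open Summit.MatrixMultiplication.MatrixMultiplication.Theorems.FarEdgeDescentStrassenFloorShift

variable (K : Type) [Field K] {p : ℕ}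

/-! ## §1 Anchored objects -/

/-- **Anchored objects.**  For the anchored direct sums `⟨1,Q,1⟩ ⊕ ⊕ᵢ⟨kᵢ,mᵢ,kᵢ⟩` of the anchor-budget
dial (kernels XXXVII/XXXVIII: cost model `r = Q + βL`, `L = ∑ kᵢmᵢ`), Strassen's floor reads
`Q + L + ∑_{i∈S} mᵢ ≤ R̲`: **the budget factor `β = 1` is unattainable** as soon as one leg has `kᵢ ≥ 2`.
[cite: BurgisserClausenShokrollahi1997, Thm. (19.12)] -/
theorem anchored_floor (k m : Fin p → ℕ) (Q : ℕ) (S : Finset (Fin p)) (hS : ∀ i ∈ S, 2 ≤ k i) :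
    Q + ∑ i, k i * m i + ∑ i ∈ S, m i ≤
      algBorderRank (matMulDirectSum K (Fin.cons 1 k) (Fin.cons Q m) (Fin.cons 1 k)) := by
  classical
  have hS' : ∀ j ∈ S.map (Fin.succEmb p), 2 ≤ (Fin.cons 1 k : Fin (p + 1) → ℕ) j := by
    intro j hj
    rw [Finset.mem_map] at hj
    obtain ⟨i, hi, rfl⟩ := hj
    simpa using hS i hi
  have hf := floor K (Fin.cons 1 k) (Fin.cons Q m) (S.map (Fin.succEmb p)) hS'
  rw [Finset.sum_map] at hf
  simpa [Fin.sum_univ_succ, add_assoc] using hf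

/-- The shift floor for anchored objects: `2(Q + L) + ∑_{i∈S}(kᵢ−1)mᵢ ≤ 2R̲(⟨1,Q,1⟩ ⊕ ⊕ᵢ⟨kᵢ,mᵢ,kᵢ⟩)`.
[cite: BurgisserClausenShokrollahi1997, Thm. (19.12)] -/
theorem anchored_floor_shift (k m : Fin p → ℕ) (Q : ℕ) (S : Finset (Fin p)) :
    2 * (Q + ∑ i, k i * m i) + ∑ i ∈ S, (k i - 1) * m i ≤
      2 * algBorderRank (matMulDirectSum K (Fin.cons 1 k) (Fin.cons Q m) (Fin.cons 1 k)) := by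
  classical
  have hf := floor_shift K (Fin.cons 1 k) (Fin.cons Q m) (S.map (Fin.succEmb p))
  rw [Finset.sum_map] at hf
  have e1 : ∑ j : Fin (p + 1), (Fin.cons 1 k : Fin (p + 1) → ℕ) j * (Fin.cons Q m : Fin (p + 1) → ℕ) j =
      Q + ∑ i, k i * m i := by
    simp [Fin.sum_univ_succ]
  have e2 : ∑ i ∈ S, ((Fin.cons 1 k : Fin (p + 1) → ℕ) ((Fin.succEmb p) i) - 1) *
      (Fin.cons Q m : Fin (p + 1) → ℕ) ((Fin.succEmb p) i) = ∑ i ∈ S, (k i - 1) * m i := by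
    simp
  omega

/-- **The uniform anchored floor `3Q + 4L ≤ 3R̲`**: if every leg is genuine (`kᵢ ≥ 2`) then
`3Q + 4∑kᵢmᵢ ≤ 3R̲(⟨1,Q,1⟩ ⊕ ⊕ᵢ⟨kᵢ,mᵢ,kᵢ⟩)`, for every anchor `Q`, over every field.
[cite: BurgisserClausenShokrollahi1997, Thm. (19.12)] -/
theorem anchored_uniform_floor (k m : Fin p → ℕ) (Q : ℕ) (hk : ∀ i, 2 ≤ k i) :
    3 * Q + 4 * ∑ i, k i * m i ≤
      3 * algBorderRank (matMulDirectSum K (Fin.cons 1 k) (Fin.cons Q m) (Fin.cons 1 k)) := by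
  classical
  have hA := anchored_floor K k m Q Finset.univ (fun i _ => hk i)
  have hB := anchored_floor_shift K k m Q Finset.univ
  have hsum : ∑ i, (k i - 1) * m i + ∑ i, m i = ∑ i, k i * m i := by
    rw [← Finset.sum_add_distrib]
    refine Finset.sum_congr rfl fun i _ => ?_
    have h1 : 1 ≤ k i := le_trans (by norm_num) (hk i)
    calc (k i - 1) * m i + m i = (k i - 1) * m i + 1 * m i := by rw [one_mul]
      _ = (k i - 1 + 1) * m i := (add_mul _ _ _).symm
      _ = k i * m i := by rw [Nat.sub_add_cancel h1]
  omega

/-- **The anchored pair `⟨1,Q,1⟩ ⊕ ⟨a,B,a⟩`** (one anchor, one leg — the base object of every certificate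
in the tree, `Fin.cons`/`![·,·]` format): `Q + aB + B ≤ R̲`, for every `a ≥ 2`.  For `a = 2` this is
`Q + 3B`, tight up to `O(1)` against Strassen's algorithm on the leg.
[cite: BurgisserClausenShokrollahi1997, Thm. (19.12)] -/
theorem anchoredPair_floor (Q a B : ℕ) (ha : 2 ≤ a) :
    Q + a * B + B ≤ algBorderRank (matMulDirectSum K ![1, a] ![Q, B] ![1, a]) := by
  have hf := floor K ![1, a] ![Q, B] {1} (fun j hj => by
    rw [Finset.mem_singleton] at hj; rw [hj]; simpa using ha)
  simpa [Fin.sum_univ_two] using hf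

/-- The anchored pair, uniform form: `3Q + 4aB ≤ 3R̲(⟨1,Q,1⟩ ⊕ ⟨a,B,a⟩)` for every `a ≥ 2`.
[cite: BurgisserClausenShokrollahi1997, Thm. (19.12)] -/
theorem anchoredPair_uniform_floor (Q a B : ℕ) (ha : 2 ≤ a) :
    3 * Q + 4 * (a * B) ≤ 3 * algBorderRank (matMulDirectSum K ![1, a] ![Q, B] ![1, a]) := by
  have hf := anchored_uniform_floor K ![a] ![B] Q (fun i => by fin_cases i; simpa using ha)
  simp only [Finset.univ_unique, Fin.default_eq_zero, Finset.sum_singleton, Matrix.cons_val_zero] at hf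
  exact hf

/-! ## §2 The dial's budget factor -/

/-- **The dial's budget factor is bounded away from `1` by the leg width.**  If an anchored direct sum
`⟨1,Q,1⟩ ⊕ ⊕ᵢ⟨kᵢ,mᵢ,kᵢ⟩` with legs of outer width `2 ≤ kᵢ ≤ a` and leg mass `L = ∑ kᵢmᵢ > 0` admits a
certificate `R̲ ≤ Q + β·L` (the cost law of the anchor-budget dial, kernel XXXVIII-C `dial_of_budget`),
then `β ≥ 1 + 1/a`.  So legs of width `a` live at dial parameter `β ≥ 1 + 1/a` (`a = 2`: `β ≥ 3/2`,
`θ_{3/2} = 1.409…`; `β → 1⁺` forces `a → ∞`). [cite: BurgisserClausenShokrollahi1997, Thm. (19.12)] -/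
theorem budget_floor (k m : Fin p → ℕ) (Q a : ℕ) (ha : 1 ≤ a) (hk : ∀ i, 2 ≤ k i ∧ k i ≤ a)
    (hL : 0 < ∑ i, k i * m i) {β : ℝ}
    (h : (algBorderRank (matMulDirectSum K (Fin.cons 1 k) (Fin.cons Q m) (Fin.cons 1 k)) : ℝ) ≤
      Q + β * ∑ i, k i * m i) :
    1 + 1 / (a : ℝ) ≤ β := by
  classical
  have hf := anchored_floor K k m Q Finset.univ (fun i _ => (hk i).1)
  have hLa : ∑ i, k i * m i ≤ a * ∑ i, m i := by
    rw [Finset.mul_sum]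
    exact Finset.sum_le_sum fun i _ => Nat.mul_le_mul_right _ (hk i).2
  have hf' : ((Q + ∑ i, k i * m i + ∑ i, m i : ℕ) : ℝ) ≤ Q + β * ∑ i, k i * m i := by
    exact le_trans (by exact_mod_cast hf) h
  have hLa' : ((∑ i, k i * m i : ℕ) : ℝ) ≤ (a : ℝ) * ((∑ i, m i : ℕ) : ℝ) := by exact_mod_cast hLa
  have hL' : (0 : ℝ) < ((∑ i, k i * m i : ℕ) : ℝ) := by exact_mod_cast hL
  have ha' : (0 : ℝ) < a := by exact_mod_cast (by omega : 0 < a)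
  push_cast at hf' hLa' hL' ⊢
  set L : ℝ := ∑ i, ((k i : ℝ) * (m i : ℝ)) with hLdef
  set M : ℝ := ∑ i, (m i : ℝ) with hMdef
  -- `L + M ≤ βL`, `L ≤ aM`, `L > 0` ⟹ `β ≥ 1 + 1/a`
  have h1 : L + L / a ≤ β * L := by
    have : L / a ≤ M := by rw [div_le_iff₀ ha']; linarith
    linarith
  have h2 : (1 + 1 / (a : ℝ)) * L ≤ β * L := by rw [add_mul, one_mul, one_div_mul_eq_div]; exact h1
  exact le_of_mul_le_mul_right h2 hL'

/-- **`β ≥ 4/3`, uniformly.**  If an anchored direct sum `⟨1,Q,1⟩ ⊕ ⊕ᵢ⟨kᵢ,mᵢ,kᵢ⟩` with genuine legs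
(`kᵢ ≥ 2`, any widths, any number) and leg mass `L > 0` admits a certificate `R̲ ≤ Q + β·L` (the cost law
of the anchor-budget dial), then `β ≥ 4/3` — for every anchor `Q`, over every field.  In the dial model the
power world passes every such toolbox at order `θ_{4/3} = 2.106…`; the range `β < 4/3` is empty.
[cite: BurgisserClausenShokrollahi1997, Thm. (19.12)] -/
theorem budget_floor_uniform (k m : Fin p → ℕ) (Q : ℕ) (hk : ∀ i, 2 ≤ k i)
    (hL : 0 < ∑ i, k i * m i) {β : ℝ}
    (h : (algBorderRank (matMulDirectSum K (Fin.cons 1 k) (Fin.cons Q m) (Fin.cons 1 k)) : ℝ) ≤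
      Q + β * ∑ i, k i * m i) :
    4 / 3 ≤ β := by
  have hf := anchored_uniform_floor K k m Q hk
  have hR : ((3 * Q + 4 * ∑ i, k i * m i : ℕ) : ℝ) ≤
      3 * (algBorderRank (matMulDirectSum K (Fin.cons 1 k) (Fin.cons Q m) (Fin.cons 1 k)) : ℝ) := by
    exact_mod_cast hf
  have hf' : ((3 * Q + 4 * ∑ i, k i * m i : ℕ) : ℝ) ≤ 3 * (Q + β * ∑ i, k i * m i) :=
    hR.trans (by linarith)
  have hL' : (0 : ℝ) < ((∑ i, k i * m i : ℕ) : ℝ) := by exact_mod_cast hL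
  push_cast at hf' hL' ⊢
  set L : ℝ := ∑ i, ((k i : ℝ) * (m i : ℝ)) with hLdef
  have h2 : (4 / 3 : ℝ) * L ≤ β * L := by linarith
  exact le_of_mul_le_mul_right h2 hL'

/-- **Wide legs are pushed to Strassen's `3/2`.**  If every leg has width `kᵢ ≥ a ≥ 1` then a certificate
`R̲ ≤ Q + β·L` forces `β ≥ 3/2 − 1/(2a)`. [cite: BurgisserClausenShokrollahi1997, Thm. (19.12)] -/
theorem budget_floor_wide (k m : Fin p → ℕ) (Q a : ℕ) (ha : 1 ≤ a) (hk : ∀ i, a ≤ k i)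
    (hL : 0 < ∑ i, k i * m i) {β : ℝ}
    (h : (algBorderRank (matMulDirectSum K (Fin.cons 1 k) (Fin.cons Q m) (Fin.cons 1 k)) : ℝ) ≤
      Q + β * ∑ i, k i * m i) :
    3 / 2 - 1 / (2 * (a : ℝ)) ≤ β := by
  classical
  have hf := anchored_floor_shift K k m Q Finset.univ
  have hsum : ∑ i, (k i - 1) * m i + ∑ i, m i = ∑ i, k i * m i := by
    rw [← Finset.sum_add_distrib]
    refine Finset.sum_congr rfl fun i _ => ?_
    have h1 : 1 ≤ k i := le_trans ha (hk i)
    calc (k i - 1) * m i + m i = (k i - 1) * m i + 1 * m i := by rw [one_mul]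
      _ = (k i - 1 + 1) * m i := (add_mul _ _ _).symm
      _ = k i * m i := by rw [Nat.sub_add_cancel h1]
  have hMa : a * ∑ i, m i ≤ ∑ i, k i * m i := by
    rw [Finset.mul_sum]
    exact Finset.sum_le_sum fun i _ => Nat.mul_le_mul_right _ (hk i)
  have hR : ((2 * (Q + ∑ i, k i * m i) + ∑ i, (k i - 1) * m i : ℕ) : ℝ) ≤
      2 * (algBorderRank (matMulDirectSum K (Fin.cons 1 k) (Fin.cons Q m) (Fin.cons 1 k)) : ℝ) := by
    exact_mod_cast hf
  have hf' : ((2 * (Q + ∑ i, k i * m i) + ∑ i, (k i - 1) * m i : ℕ) : ℝ) ≤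
      2 * (Q + β * ∑ i, k i * m i) := hR.trans (by linarith)
  have hsum' : ((∑ i, (k i - 1) * m i : ℕ) : ℝ) + ((∑ i, m i : ℕ) : ℝ) = ((∑ i, k i * m i : ℕ) : ℝ) := by
    exact_mod_cast hsum
  have hMa' : (a : ℝ) * ((∑ i, m i : ℕ) : ℝ) ≤ ((∑ i, k i * m i : ℕ) : ℝ) := by exact_mod_cast hMa
  have hL' : (0 : ℝ) < ((∑ i, k i * m i : ℕ) : ℝ) := by exact_mod_cast hL
  have ha' : (0 : ℝ) < a := by exact_mod_cast (by omega : 0 < a)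
  have hf'' : 2 * ((Q : ℝ) + ((∑ i, k i * m i : ℕ) : ℝ)) + ((∑ i, (k i - 1) * m i : ℕ) : ℝ) ≤
      2 * (Q + β * ((∑ i, k i * m i : ℕ) : ℝ)) := by
    have e : ((2 * (Q + ∑ i, k i * m i) + ∑ i, (k i - 1) * m i : ℕ) : ℝ) =
        2 * ((Q : ℝ) + ((∑ i, k i * m i : ℕ) : ℝ)) + ((∑ i, (k i - 1) * m i : ℕ) : ℝ) := by
      norm_cast
    rw [← e]
    exact hf'
  set L : ℝ := ((∑ i, k i * m i : ℕ) : ℝ) with hLdef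
  set M : ℝ := ((∑ i, m i : ℕ) : ℝ) with hMdef
  set P : ℝ := ((∑ i, (k i - 1) * m i : ℕ) : ℝ) with hPdef
  -- `2L + P ≤ 2βL`, `P = L − M`, `aM ≤ L`, `L > 0` ⟹ `β ≥ 3/2 − 1/(2a)`
  have hM' : M ≤ L / a := by rw [le_div_iff₀ ha']; linarith
  have key : 3 / 2 * L - (L / a) / 2 ≤ β * L := by linarith
  have e : (3 / 2 - 1 / (2 * (a : ℝ))) * L = 3 / 2 * L - (L / a) / 2 := by ring
  rw [← e] at key
  exact le_of_mul_le_mul_right key hL'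

/-! ## §3 Bare multiples -/


/-- **Bare multiples `⟨c⟩ ⊗ ⟨A,M,A⟩`** (the objects read out by `FarEdgeDescentTower.excess_le_of_cert`):
`c(A+1)M ≤ R̲(⟨c⟩ ⊗ ⟨A,M,A⟩)` for `A ≥ 2` — the relative surplus `1/A` does NOT wash out with the
multiplicity `c`. [cite: BurgisserClausenShokrollahi1997, Thm. (19.12)] [cite: Blaser2013, §5.2 p. 24] -/
theorem multiple_floor (c A M : ℕ) (hA : 2 ≤ A) :
    c * (A * M) + c * M ≤ algBorderRank (kroneckerTensor (unitTensor K c) (matMulTensor K A M A)) := by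
  classical
  have hf := floor K (fun _ : Fin c => A) (fun _ => M) Finset.univ (fun _ _ => hA)
  simp only [Finset.sum_const, Finset.card_univ, Fintype.card_fin, smul_eq_mul] at hf
  exact hf.trans (FarEdgeDescentTower.tensorRestrictsTo_multiple_directSum K c A M).algBorderRank_le

/-- The shift floor for bare multiples: `2cAM + c(A−1)M ≤ 2R̲(⟨c⟩ ⊗ ⟨A,M,A⟩)` — relative surplus
`(A−1)/(2A)`, tending to Strassen's `1/2` for wide `A`. [cite: BurgisserClausenShokrollahi1997, Thm. (19.12)] -/
theorem multiple_shift_floor (c A M : ℕ) :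
    2 * (c * (A * M)) + c * ((A - 1) * M) ≤
      2 * algBorderRank (kroneckerTensor (unitTensor K c) (matMulTensor K A M A)) := by
  classical
  have hf := floor_shift K (fun _ : Fin c => A) (fun _ => M) Finset.univ
  simp only [Finset.sum_const, Finset.card_univ, Fintype.card_fin, smul_eq_mul] at hf
  exact hf.trans (Nat.mul_le_mul_left 2
    (FarEdgeDescentTower.tensorRestrictsTo_multiple_directSum K c A M).algBorderRank_le)

/-- **The uniform floor for bare multiples: `4cAM ≤ 3R̲(⟨c⟩ ⊗ ⟨A,M,A⟩)`** for `A ≥ 2`.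
[cite: BurgisserClausenShokrollahi1997, Thm. (19.12)] [cite: Blaser2013, §5.2 p. 24] -/
theorem multiple_uniform_floor (c A M : ℕ) (hA : 2 ≤ A) :
    4 * (c * (A * M)) ≤ 3 * algBorderRank (kroneckerTensor (unitTensor K c) (matMulTensor K A M A)) := by
  classical
  have hf := uniform_floor K (fun _ : Fin c => A) (fun _ => M) (fun _ => hA)
  simp only [Finset.sum_const, Finset.card_univ, Fintype.card_fin, smul_eq_mul] at hf
  exact hf.trans (Nat.mul_le_mul_left 3
    (FarEdgeDescentTower.tensorRestrictsTo_multiple_directSum K c A M).algBorderRank_le)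

/-- In particular **no bare multiple of a genuine matrix product is of minimal border rank**:
`¬ R̲(⟨c⟩ ⊗ ⟨A,M,A⟩) ≤ cAM` (`c, M ≥ 1`, `A ≥ 2`). [cite: BurgisserClausenShokrollahi1997, Thm. (19.12)] -/
theorem not_minimal_multiple {c A M : ℕ} (hc : 1 ≤ c) (hA : 2 ≤ A) (hM : 1 ≤ M) :
    ¬ algBorderRank (kroneckerTensor (unitTensor K c) (matMulTensor K A M A)) ≤ c * (A * M) := by
  have hf := multiple_floor K c A M hA
  have hcM : 1 ≤ c * M := Nat.one_le_iff_ne_zero.2 (Nat.mul_ne_zero (by omega) (by omega))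
  omega

/-! ## §4 The `β = 1` readout and its floors -/


/-- **The one-shot readout from a bare multiple** (the `β`-free dictionary behind
`FarEdgeDescentTower.excess_le_of_cert`): a certificate `R̲(⟨c⟩ ⊗ ⟨A,M,A⟩) ≤ r` gives
`c · A^{ω(1,x*,1)} ≤ r` at `x* = log M / log A` (rectangular asymptotic sum inequality with multiplicity
and `R̃ ≤ R̲`).  With `r = cAM` exactly (budget factor `β = 1`, minimal border rank) and `M = Aⁿ` this
would be `ω(1,n,1) = n + 1`, i.e. `FiniteSaturation` — `omegaRect_eq_of_minimal_multiple` below; by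
`not_minimal_multiple` that door is shut for every `c`, and by `multiple_floor` the best this readout can
ever certify is `ω(1,x*,1) − (x*+1) ≤ log(1 + 1/A)/log A` (`readout_floor`).
[cite: AlmanDuanVassilevskaWilliamsXuXuZhou2025, Thm. 3.2] [cite: LottiRomani1983, Prop. 4.1] -/
theorem readout {c A M r : ℕ} (hc : 1 ≤ c) (hA : 2 ≤ A) (hM : 1 ≤ M)
    (h : algBorderRank (kroneckerTensor (unitTensor K c) (matMulTensor K A M A)) ≤ r) :
    (c : ℝ) * (A : ℝ) ^ omegaRect K 1 (Real.log M / Real.log A) 1 ≤ r := by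
  have hA0 : (0 : ℝ) < A := by exact_mod_cast (by omega : 0 < A)
  have hM0 : (0 : ℝ) < M := by exact_mod_cast (by omega : 0 < M)
  have hlA : 0 < Real.log A := Real.log_pos (by exact_mod_cast (by omega : 1 < A))
  have hlM : 0 ≤ Real.log M := Real.log_nonneg (by exact_mod_cast hM)
  have hx0 : 0 ≤ Real.log M / Real.log A := div_nonneg hlM hlA.le
  have hxA : Real.log M / Real.log A * Real.log A = Real.log M := div_mul_cancel₀ _ hlA.ne'
  have hAx : (A : ℝ) ^ (Real.log M / Real.log A) ≤ (M : ℕ) := by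
    rw [Real.rpow_def_of_pos hA0, mul_comm, hxA, Real.exp_log hM0]
  have h1 := mul_rpow_omegaRect_mid_le_asymptoticRank K hx0 hc hA hAx
  have h2 : asymptoticRank (kroneckerTensor (unitTensor K c) (matMulTensor K A M A)) ≤ (r : ℝ) := by
    exact_mod_cast asymptoticRank_le_of_algBorderRank_le h
  exact h1.trans h2

/-- **The shut door, as a dictionary entry**: a bare multiple `⟨c⟩ ⊗ ⟨A, Aⁿ, A⟩` of MINIMAL border rank
`c·A·Aⁿ` would give `ω(1,n,1) = n + 1` on the nose (the `∃`-witness of `FiniteSaturation` at `k = n`).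
Its hypothesis is refuted by `not_minimal_multiple` for every `c ≥ 1`, `A ≥ 2`, `n ≥ 0`: the `β = 1`
endpoint of the anchor-budget dial carries no tensor.
[cite: AlmanDuanVassilevskaWilliamsXuXuZhou2025, Thm. 3.2] -/
theorem omegaRect_eq_of_minimal_multiple {c A n : ℕ} (hc : 1 ≤ c) (hA : 2 ≤ A)
    (h : algBorderRank (kroneckerTensor (unitTensor K c) (matMulTensor K A (A ^ n) A)) ≤ c * (A * A ^ n)) :
    omegaRect K 1 n 1 = n + 1 := by
  have hA0 : (0 : ℝ) < A := by exact_mod_cast (by omega : 0 < A)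
  have hA1 : (1 : ℝ) < A := by exact_mod_cast (by omega : 1 < A)
  have hc0 : (0 : ℝ) < c := by exact_mod_cast (by omega : 0 < c)
  have hAx : (A : ℝ) ^ (n : ℝ) ≤ ((A ^ n : ℕ) : ℝ) := by
    rw [Real.rpow_natCast]; push_cast; exact le_rfl
  have h1 := mul_rpow_omegaRect_mid_le_asymptoticRank K (Nat.cast_nonneg n) hc hA hAx
  have h2 : asymptoticRank (kroneckerTensor (unitTensor K c) (matMulTensor K A (A ^ n) A)) ≤
      ((c * (A * A ^ n) : ℕ) : ℝ) := by
    exact_mod_cast asymptoticRank_le_of_algBorderRank_le h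
  have h3 : (A : ℝ) ^ omegaRect K 1 n 1 ≤ (A : ℝ) ^ ((n : ℝ) + 1) := by
    have h12 := h1.trans h2
    push_cast at h12
    have hpow : (A : ℝ) ^ ((n : ℝ) + 1) = A * A ^ n := by
      rw [Real.rpow_add hA0, Real.rpow_natCast, Real.rpow_one, mul_comm]
    rw [hpow]
    exact le_of_mul_le_mul_left h12 hc0
  have h4 : omegaRect K 1 n 1 ≤ (n : ℝ) + 1 := (Real.rpow_le_rpow_left_iff hA1).1 h3
  exact le_antisymm h4 (add_one_le_omegaRect_one_mid_one K (n : ℝ))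

/-- **The floor of the readout**: whatever certificate `R̲(⟨c⟩ ⊗ ⟨A,M,A⟩) ≤ r` is fed to `readout`,
`r ≥ c(A+1)M`, so the certified bound is never better than `c·A^{ω(1,x*,1)} ≤ c(A+1)M`, i.e.
`ω(1,x*,1) ≤ x* + 1 + log(1+1/A)/log A` — bounded away from saturation at every finite `A`.
[cite: BurgisserClausenShokrollahi1997, Thm. (19.12)] -/
theorem readout_floor {c A M r : ℕ} (hA : 2 ≤ A)
    (h : algBorderRank (kroneckerTensor (unitTensor K c) (matMulTensor K A M A)) ≤ r) :
    (c : ℝ) * ((A : ℝ) + 1) * M ≤ r := by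
  have hf := (multiple_floor K c A M hA).trans h
  have : ((c * (A * M) + c * M : ℕ) : ℝ) ≤ r := by exact_mod_cast hf
  push_cast at this
  nlinarith [this]

/-- The uniform floor of the readout: `4cAM ≤ 3r` for ANY certificate `R̲(⟨c⟩ ⊗ ⟨A,M,A⟩) ≤ r` with
`A ≥ 2` — the one-shot readout never certifies better than `A^{ω(1,x*,1) − (x*+1)} ≥ 4/3`-worth of slack,
at every width `A`. [cite: BurgisserClausenShokrollahi1997, Thm. (19.12)] -/
theorem readout_uniform_floor {c A M r : ℕ} (hA : 2 ≤ A)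
    (h : algBorderRank (kroneckerTensor (unitTensor K c) (matMulTensor K A M A)) ≤ r) :
    4 * (c * (A * M)) ≤ 3 * r :=
  (multiple_uniform_floor K c A M hA).trans (Nat.mul_le_mul_left 3 h)

end Summit.MatrixMultiplication.MatrixMultiplication.Theorems.FarEdgeDescentStrassenFloorReadout

end
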